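import Summits.Ventures.LatticeQCDFlow.Scoring.SlidingWindowChain
import Summits.Ventures.LatticeQCDFlow.Exactness.NCMCGeneralSpaceDoeblinPowerCLT

/-!
# The CLT for time averages of WINDOW FUNCTIONALS `φ(X_t, …, X_{t+W})` of a chain with a Doeblin
# power, from EVERY initial law: `(√n)⁻¹ Σ_{t<n} (φ(X_t, …, X_{t+W}) − E_π φ) ⇒ N(0, σ²_φ)` with the
# Green–Kubo variance of the window process

HONEST FRAMING: exact (Metropolis-corrected) sampling algorithms for lattice gauge theory;
figures of merit are autocorrelation/cost numbers at stated couplings and volumes; no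
continuum-physics claim.

Venture `LatticeQCDFlow` (cell pub-lqcd), sub-topic `Scoring`; FANOUT row 16 (`su2-base`), GEN-9.
NEW WORK of the cell, not a published result; one definition (`windowLRVar`: the variance of the CLT,
named for reuse by the next files); nothing is cited as a fact (the CLT for functionals of finitely many coordinates of a uniformly ergodic chain — e.g.
Meyn–Tweedie 1993 Thm 17.0.1 with §3.4's sliding-block chain; Ibragimov–Linnik 1971 Ch. 18–19 —
NAMED ONLY).  ASSEMBLY of row 13's any-start CLT under a Doeblin power
(`Exactness/NCMCGeneralSpaceDoeblinPowerCLT.tendstoInDistribution_timeAverage_of_nHit`) with GEN-9's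
sliding-window chain (`Scoring/SlidingWindowChain.lean`: the window chain has a Doeblin power with
the same constant, the stationary window law is invariant, and the law of the window path under
`P_{μ₀}` is the window chain).  Row 13's `NCMCGeneralSpacePairFunctionalCLT` is the case `W = 1` by a
different route (pair martingale increments) and lists 'functionals of longer windows' and 'the
Green–Kubo form of the variance for pair functionals' as NOT CLAIMED; both are supplied here, for
every `W`.  The lag products `f̄(X_t) f̄(X_{t+s})`, `s ≤ W`, of the scorers' autocovariance estimates
are the window functionals the next files use (`Scoring/ChainLagProductCLT.lean`).

## Content (`κ` Markov on `S`, `π` invariant, `(nHit κ m)(z, ·) ≥ ε ν` for all `z`, `ε ≠ 0`, `0 < m`;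
## `φ : (Fin (W+1) → S) → ℝ` measurable with `|φ| ≤ C`; `P_{μ₀}` row 8's chain law, `μ₀` ANY initial law;
## `Y_t = (X_t, …, X_{t+W}) = windowPath W X t`; `m_φ = E_{P_π} φ(Y_0)`)

* `integral_windowLaw`, **`integral_iterate_kop_windowKernel`** — the
  window-chain quantities in chain terms: `∫ φ dπ_W = E_π φ(Y_0)`,
  `∫ φ̄ · (κ_W)^{k} φ̄ dπ_W = E_π[φ̄(Y_0) φ̄(Y_k)]` (`φ̄ = φ − m_φ`);
* `windowLRVar κ π W ψ` [ours] — the long-run (Green–Kubo) variance of a window series under `P_π`: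
  `E_π[ψ̄(Y_0)²] + 2 Σ_{k≥0} E_π[ψ̄(Y_0) ψ̄(Y_{k+1})]`, `ψ̄ = ψ − E_π ψ(Y_0)`;
  **`windowLRVar_eq_greenKubo`** — it IS the Green–Kubo variance of `ψ` along the window chain
  `windowKernel κ W` in its invariant law `π_W` (so row 13's Poisson-equation identities apply to it);
* **`tendstoInDistribution_windowAverage_of_nHit`** — THE THEOREM: with
  `σ²_φ = windowLRVar κ π W φ`, for EVERY initial law `μ₀` and every real random variable
  `Z ∼ N(0, σ²_φ)`:
  `TendstoInDistribution (fun n x => (√n)⁻¹ Σ_{t<n} (φ(windowPath W x t) − m_φ)) atTop Z (fun _ => P_{μ₀}) P'`.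

NOT CLAIMED: a rate; unbounded `φ`; `σ²_φ > 0`; infinitely many coordinates; chains without a Doeblin
power.
-/

noncomputable section

open MeasureTheory ProbabilityTheory Filter Finset Preorder
open scoped ENNReal Topology
open Summit.Ventures.LatticeQCDFlow.Exactness Summit.Ventures.LatticeQCDFlow.Exactness.GeneralNCMC

namespace Summit.Ventures.LatticeQCDFlow.Scoring

variable {S : Type*} [MeasurableSpace S]

section LRVar

/-! ## The long-run variance of a window series under the stationary chain -/

/-- **The long-run (Green–Kubo) variance of the window series `ψ(Y_k)`, `Y_k = (X_k, …, X_{k+W})`, under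
the stationary chain law `P_π`**: with `m_ψ = E_{P_π} ψ(Y_0)`,
`windowLRVar κ π W ψ = E_π[(ψ(Y_0) − m_ψ)²] + 2 Σ_{k≥0} E_π[(ψ(Y_0) − m_ψ)(ψ(Y_{k+1}) − m_ψ)]`
(the variance of the CLT below; `Σ'` is Lean's `tsum`). [ours] -/
def windowLRVar (κ : Kernel S S) [IsMarkovKernel κ] (π : Measure S) (W : ℕ)
    (ψ : (Fin (W + 1) → S) → ℝ) : ℝ :=
  (∫ x, (ψ (windowPath W x 0) - ∫ x', ψ (windowPath W x' 0)
      ∂(Kernel.trajMeasure (X := fun _ : ℕ => S) π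
        (fun n : ℕ => κ.comap (fun hh : (i : ↥(Finset.Iic n)) → S => hh ⟨n, Finset.mem_Iic.2 le_rfl⟩)
          (measurable_pi_apply _)))) ^ 2
    ∂(Kernel.trajMeasure (X := fun _ : ℕ => S) π
      (fun n : ℕ => κ.comap (fun hh : (i : ↥(Finset.Iic n)) → S => hh ⟨n, Finset.mem_Iic.2 le_rfl⟩)
        (measurable_pi_apply _))))
  + 2 * ∑' k, ∫ x, (ψ (windowPath W x 0) - ∫ x', ψ (windowPath W x' 0)
      ∂(Kernel.trajMeasure (X := fun _ : ℕ => S) π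
        (fun n : ℕ => κ.comap (fun hh : (i : ↥(Finset.Iic n)) → S => hh ⟨n, Finset.mem_Iic.2 le_rfl⟩)
          (measurable_pi_apply _))))
    * (ψ (windowPath W x (k + 1)) - ∫ x', ψ (windowPath W x' 0)
      ∂(Kernel.trajMeasure (X := fun _ : ℕ => S) π
        (fun n : ℕ => κ.comap (fun hh : (i : ↥(Finset.Iic n)) → S => hh ⟨n, Finset.mem_Iic.2 le_rfl⟩)
          (measurable_pi_apply _))))
    ∂(Kernel.trajMeasure (X := fun _ : ℕ => S) π
      (fun n : ℕ => κ.comap (fun hh : (i : ↥(Finset.Iic n)) → S => hh ⟨n, Finset.mem_Iic.2 le_rfl⟩)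
        (measurable_pi_apply _)))

/-- Unfolding lemma for `windowLRVar`. -/
theorem windowLRVar_eq (κ : Kernel S S) [IsMarkovKernel κ] (π : Measure S) (W : ℕ)
    (ψ : (Fin (W + 1) → S) → ℝ) :
    windowLRVar κ π W ψ
      = (∫ x, (ψ (windowPath W x 0) - ∫ x', ψ (windowPath W x' 0)
          ∂(Kernel.trajMeasure (X := fun _ : ℕ => S) π
            (fun n : ℕ => κ.comap (fun hh : (i : ↥(Finset.Iic n)) → S => hh ⟨n, Finset.mem_Iic.2 le_rfl⟩)
              (measurable_pi_apply _)))) ^ 2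
        ∂(Kernel.trajMeasure (X := fun _ : ℕ => S) π
          (fun n : ℕ => κ.comap (fun hh : (i : ↥(Finset.Iic n)) → S => hh ⟨n, Finset.mem_Iic.2 le_rfl⟩)
            (measurable_pi_apply _))))
      + 2 * ∑' k, ∫ x, (ψ (windowPath W x 0) - ∫ x', ψ (windowPath W x' 0)
          ∂(Kernel.trajMeasure (X := fun _ : ℕ => S) π
            (fun n : ℕ => κ.comap (fun hh : (i : ↥(Finset.Iic n)) → S => hh ⟨n, Finset.mem_Iic.2 le_rfl⟩)
              (measurable_pi_apply _))))
        * (ψ (windowPath W x (k + 1)) - ∫ x', ψ (windowPath W x' 0)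
          ∂(Kernel.trajMeasure (X := fun _ : ℕ => S) π
            (fun n : ℕ => κ.comap (fun hh : (i : ↥(Finset.Iic n)) → S => hh ⟨n, Finset.mem_Iic.2 le_rfl⟩)
              (measurable_pi_apply _))))
        ∂(Kernel.trajMeasure (X := fun _ : ℕ => S) π
          (fun n : ℕ => κ.comap (fun hh : (i : ↥(Finset.Iic n)) → S => hh ⟨n, Finset.mem_Iic.2 le_rfl⟩)
            (measurable_pi_apply _))) := rfl

end LRVar

section WindowCLT

variable (κ : Kernel S S) [IsMarkovKernel κ] (W : ℕ) {π : Measure S} [IsProbabilityMeasure π]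

/-! ## The window-chain quantities in terms of the original chain -/

omit [IsProbabilityMeasure π] in
/-- `∫ φ dπ_W = E_{P_π} φ(Y_0)` for the stationary window law `π_W = P_π.map (x ↦ Y_0)`. -/
theorem integral_windowLaw {φ : (Fin (W + 1) → S) → ℝ} (hφ : Measurable φ) :
    ∫ y, φ y ∂((Kernel.trajMeasure (X := fun _ : ℕ => S) π
        (fun n : ℕ => κ.comap (fun hh : (i : ↥(Finset.Iic n)) → S => hh ⟨n, Finset.mem_Iic.2 le_rfl⟩)
          (measurable_pi_apply _))).map (fun x : ℕ → S => windowPath W x 0))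
      = ∫ x, φ (windowPath W x 0) ∂(Kernel.trajMeasure (X := fun _ : ℕ => S) π
        (fun n : ℕ => κ.comap (fun hh : (i : ↥(Finset.Iic n)) → S => hh ⟨n, Finset.mem_Iic.2 le_rfl⟩)
          (measurable_pi_apply _))) :=
  integral_map (measurable_windowPath_at 0).aemeasurable hφ.aestronglyMeasurable

/-- **Two-time moments of the window chain are two-window moments of the chain**: for `π` invariant
and bounded measurable `g, h` on windows,
`∫ g · (κ_W)^{k} h dπ_W = ∫ g(windowPath W x 0) · h(windowPath W x k) dP_π`. -/
theorem integral_iterate_kop_windowKernel (hπ : Kernel.Invariant κ π)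
    {g h : (Fin (W + 1) → S) → ℝ} (hg : Measurable g) {Cg : ℝ} (hCg : ∀ v, |g v| ≤ Cg)
    (hh : Measurable h) {Ch : ℝ} (hCh : ∀ v, |h v| ≤ Ch) (k : ℕ) :
    ∫ y, g y * (kop (windowKernel κ W))^[k] h y ∂((Kernel.trajMeasure (X := fun _ : ℕ => S) π
        (fun n : ℕ => κ.comap (fun hh : (i : ↥(Finset.Iic n)) → S => hh ⟨n, Finset.mem_Iic.2 le_rfl⟩)
          (measurable_pi_apply _))).map (fun x : ℕ → S => windowPath W x 0))
      = ∫ x, g (windowPath W x 0) * h (windowPath W x k) ∂(Kernel.trajMeasure (X := fun _ : ℕ => S) π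
        (fun n : ℕ => κ.comap (fun hh : (i : ↥(Finset.Iic n)) → S => hh ⟨n, Finset.mem_Iic.2 le_rfl⟩)
          (measurable_pi_apply _))) := by
  haveI : IsProbabilityMeasure ((Kernel.trajMeasure (X := fun _ : ℕ => S) π
      (fun n : ℕ => κ.comap (fun hh : (i : ↥(Finset.Iic n)) → S => hh ⟨n, Finset.mem_Iic.2 le_rfl⟩)
        (measurable_pi_apply _))).map (fun x : ℕ → S => windowPath W x 0)) :=
    Measure.isProbabilityMeasure_map (measurable_windowPath_at 0).aemeasurable
  have hm : Measurable fun Y : ℕ → (Fin (W + 1) → S) => g (Y 0) * h (Y (0 + k)) :=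
    (hg.comp (measurable_pi_apply 0)).mul (hh.comp (measurable_pi_apply _))
  rw [← chain_twoTime_eq_integral (κ := windowKernel κ W) (invariant_windowKernel κ W hπ) hh hCh hg hCg 0 k,
    ← chain_map_windowPath κ W π,
    integral_map (measurable_windowPath W).aemeasurable hm.aestronglyMeasurable]
  simp only [Nat.zero_add]

/-- **`windowLRVar` IS the Green–Kubo variance of `φ` along the WINDOW CHAIN in its invariant law**
`π_W = P_π.map (x ↦ Y_0)`: `∫ φ̄² dπ_W + 2 Σ_{k≥0} ∫ φ̄ · (κ_W)^{k+1} φ̄ dπ_W`, `φ̄ = φ − ∫ φ dπ_W` — the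
variance of row 13's any-start CLT applied to `windowKernel κ W`. -/
theorem windowLRVar_eq_greenKubo (hπ : Kernel.Invariant κ π) {φ : (Fin (W + 1) → S) → ℝ}
    (hφ : Measurable φ) {C : ℝ} (hC : ∀ v, |φ v| ≤ C) :
    windowLRVar κ π W φ
      = (∫ y, (φ y - ∫ y', φ y' ∂((Kernel.trajMeasure (X := fun _ : ℕ => S) π
            (fun n : ℕ => κ.comap (fun hh : (i : ↥(Finset.Iic n)) → S => hh ⟨n, Finset.mem_Iic.2 le_rfl⟩)
              (measurable_pi_apply _))).map (fun x : ℕ → S => windowPath W x 0))) ^ 2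
          ∂((Kernel.trajMeasure (X := fun _ : ℕ => S) π
            (fun n : ℕ => κ.comap (fun hh : (i : ↥(Finset.Iic n)) → S => hh ⟨n, Finset.mem_Iic.2 le_rfl⟩)
              (measurable_pi_apply _))).map (fun x : ℕ → S => windowPath W x 0)))
        + 2 * ∑' k, ∫ y, (φ y - ∫ y', φ y' ∂((Kernel.trajMeasure (X := fun _ : ℕ => S) π
            (fun n : ℕ => κ.comap (fun hh : (i : ↥(Finset.Iic n)) → S => hh ⟨n, Finset.mem_Iic.2 le_rfl⟩)
              (measurable_pi_apply _))).map (fun x : ℕ → S => windowPath W x 0)))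
          * (kop (windowKernel κ W))^[k + 1] (fun y => φ y - ∫ y', φ y'
              ∂((Kernel.trajMeasure (X := fun _ : ℕ => S) π
                (fun n : ℕ => κ.comap (fun hh : (i : ↥(Finset.Iic n)) → S =>
                  hh ⟨n, Finset.mem_Iic.2 le_rfl⟩) (measurable_pi_apply _))).map
                (fun x : ℕ → S => windowPath W x 0))) y
          ∂((Kernel.trajMeasure (X := fun _ : ℕ => S) π
            (fun n : ℕ => κ.comap (fun hh : (i : ↥(Finset.Iic n)) → S => hh ⟨n, Finset.mem_Iic.2 le_rfl⟩)
              (measurable_pi_apply _))).map (fun x : ℕ → S => windowPath W x 0)) := by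
  set Pπ := Kernel.trajMeasure (X := fun _ : ℕ => S) π
    (fun n : ℕ => κ.comap (fun hh : (i : ↥(Finset.Iic n)) → S => hh ⟨n, Finset.mem_Iic.2 le_rfl⟩)
      (measurable_pi_apply _)) with hPπ
  set c := ∫ x', φ (windowPath W x' 0) ∂Pπ with hc
  have hcW : ∫ y, φ y ∂(Pπ.map (fun x : ℕ → S => windowPath W x 0)) = c := by
    rw [hc, hPπ]; exact integral_windowLaw κ W hφ
  have hφbm : Measurable fun y => φ y - c := hφ.sub measurable_const
  have hφbC : ∀ y, |φ y - c| ≤ C + |c| := fun y => (abs_sub _ _).trans (add_le_add (hC y) le_rfl)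
  have hvar : ∫ y, (φ y - c) ^ 2 ∂(Pπ.map (fun x : ℕ → S => windowPath W x 0))
      = ∫ x, (φ (windowPath W x 0) - c) ^ 2 ∂Pπ :=
    integral_map (measurable_windowPath_at 0).aemeasurable (hφbm.pow_const 2).aestronglyMeasurable
  have hcov : ∀ k, ∫ y, (φ y - c) * (kop (windowKernel κ W))^[k + 1] (fun y => φ y - c) y
        ∂(Pπ.map (fun x : ℕ → S => windowPath W x 0))
      = ∫ x, (φ (windowPath W x 0) - c) * (φ (windowPath W x (k + 1)) - c) ∂Pπ := fun k => by
    rw [hPπ]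
    exact integral_iterate_kop_windowKernel κ W hπ hφbm hφbC hφbm hφbC (k + 1)
  rw [hcW, hvar]
  simp_rw [hcov]
  rw [windowLRVar_eq]

/-! ## The CLT for window functionals -/

/-- **THE CENTRAL LIMIT THEOREM FOR WINDOW FUNCTIONALS OF A CHAIN WITH A DOEBLIN POWER, FROM ANY
INITIAL LAW.**  `κ` Markov with invariant probability `π` and `(nHit κ m)(z, ·) ≥ ε ν` for all `z`
(`ε ≠ 0`, `0 < m`); `φ` a bounded measurable function of `W + 1` consecutive states,
`m_φ = E_{P_π} φ(Y_0)`, `φ̄ = φ − m_φ`, `σ²_φ = E_π[φ̄(Y_0)²] + 2 Σ_{k≥0} E_π[φ̄(Y_0) φ̄(Y_{k+1})]`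
(`Y_t = windowPath W X t`).  For EVERY initial law `μ₀` and every real random variable `Z` with law
`N(0, σ²_φ)`:
`TendstoInDistribution (fun n x => (√n)⁻¹ Σ_{t<n} (φ(windowPath W x t) − m_φ)) atTop Z (fun _ => P_{μ₀}) P'`.
Proof: the window path is, in law, the chain of `windowKernel κ W` from the initial-window law
(`chain_map_windowPath`); that chain has invariant law `π_W` and the Doeblin power
`(nHit κ_W (m+W)) ≥ ε ν_W` (`Scoring/SlidingWindowChain`); row 13's any-start CLT applies to it, and its
variance is `σ²_φ` by `integral_iterate_kop_windowKernel`. -/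
theorem tendstoInDistribution_windowAverage_of_nHit {ν : Measure S} [IsProbabilityMeasure ν]
    {ε : ℝ≥0∞} {m : ℕ} (hπ : Kernel.Invariant κ π) (hε : ε ≠ 0)
    (hmin : ∀ z, ε • ν ≤ nHit κ m z) (hm : 0 < m)
    {φ : (Fin (W + 1) → S) → ℝ} (hφ : Measurable φ) {C : ℝ} (hC : ∀ v, |φ v| ≤ C)
    (μ₀ : Measure S) [IsProbabilityMeasure μ₀]
    {Ω' : Type*} [MeasurableSpace Ω'] {P' : Measure Ω'} [IsProbabilityMeasure P'] {Z : Ω' → ℝ}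
    (hZ : HasLaw Z (gaussianReal 0 (windowLRVar κ π W φ).toNNReal) P')
    [IsProbabilityMeasure (Kernel.trajMeasure (X := fun _ : ℕ => S) μ₀
        (fun n : ℕ => κ.comap (fun hh : (i : ↥(Finset.Iic n)) → S => hh ⟨n, Finset.mem_Iic.2 le_rfl⟩)
          (measurable_pi_apply _)))] :
    TendstoInDistribution (fun (n : ℕ) (x : ℕ → S) =>
        (Real.sqrt n)⁻¹ * ∑ t ∈ Finset.range n, (φ (windowPath W x t) - ∫ x', φ (windowPath W x' 0)
          ∂(Kernel.trajMeasure (X := fun _ : ℕ => S) π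
            (fun n : ℕ => κ.comap (fun hh : (i : ↥(Finset.Iic n)) → S => hh ⟨n, Finset.mem_Iic.2 le_rfl⟩)
              (measurable_pi_apply _)))))
      atTop Z (fun _ => Kernel.trajMeasure (X := fun _ : ℕ => S) μ₀
        (fun n : ℕ => κ.comap (fun hh : (i : ↥(Finset.Iic n)) → S => hh ⟨n, Finset.mem_Iic.2 le_rfl⟩)
          (measurable_pi_apply _))) P' := by
  -- the three chain laws: stationary, from `ν`, from `μ₀`
  set Pπ := Kernel.trajMeasure (X := fun _ : ℕ => S) π
    (fun n : ℕ => κ.comap (fun hh : (i : ↥(Finset.Iic n)) → S => hh ⟨n, Finset.mem_Iic.2 le_rfl⟩)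
      (measurable_pi_apply _)) with hPπ
  set P := Kernel.trajMeasure (X := fun _ : ℕ => S) μ₀
    (fun n : ℕ => κ.comap (fun hh : (i : ↥(Finset.Iic n)) → S => hh ⟨n, Finset.mem_Iic.2 le_rfl⟩)
      (measurable_pi_apply _)) with hP
  -- the window-chain data
  haveI hπWp : IsProbabilityMeasure (Pπ.map (fun x : ℕ → S => windowPath W x 0)) :=
    Measure.isProbabilityMeasure_map (measurable_windowPath_at 0).aemeasurable
  haveI hνWp : IsProbabilityMeasure ((Kernel.trajMeasure (X := fun _ : ℕ => S) ν
      (fun n : ℕ => κ.comap (fun hh : (i : ↥(Finset.Iic n)) → S => hh ⟨n, Finset.mem_Iic.2 le_rfl⟩)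
        (measurable_pi_apply _))).map (fun x : ℕ → S => windowPath W x 0)) :=
    Measure.isProbabilityMeasure_map (measurable_windowPath_at 0).aemeasurable
  haveI hμWp : IsProbabilityMeasure (P.map (fun x : ℕ → S => windowPath W x 0)) :=
    Measure.isProbabilityMeasure_map (measurable_windowPath_at 0).aemeasurable
  have hπW : Kernel.Invariant (windowKernel κ W) (Pπ.map (fun x : ℕ → S => windowPath W x 0)) := by
    rw [hPπ]; exact invariant_windowKernel κ W hπ
  have hminW : ∀ y, ε • ((Kernel.trajMeasure (X := fun _ : ℕ => S) ν
      (fun n : ℕ => κ.comap (fun hh : (i : ↥(Finset.Iic n)) → S => hh ⟨n, Finset.mem_Iic.2 le_rfl⟩)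
        (measurable_pi_apply _))).map (fun x : ℕ → S => windowPath W x 0))
      ≤ nHit (windowKernel κ W) (m + W) y := windowKernel_minorised_of_nHit κ W hmin
  have hmW : 0 < m + W := by omega
  -- the constants of the window chain are those of the statement
  set c := ∫ x', φ (windowPath W x' 0) ∂Pπ with hc
  have hcW : ∫ y, φ y ∂(Pπ.map (fun x : ℕ → S => windowPath W x 0)) = c := by
    rw [hc, hPπ]; exact integral_windowLaw κ W hφ
  have hZ' := hZ
  rw [windowLRVar_eq_greenKubo κ W hπ hφ hC, ← hPπ] at hZ'
  -- row 13's any-start CLT for the window chain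
  have hclt := tendstoInDistribution_timeAverage_of_nHit (κ := windowKernel κ W) hπW hε hminW hmW hφ hC
    (P.map (fun x : ℕ → S => windowPath W x 0)) hZ'
  rw [hcW] at hclt
  -- transfer along the window-path map
  have hstatm : ∀ n : ℕ, Measurable fun Yp : ℕ → (Fin (W + 1) → S) =>
      (Real.sqrt n)⁻¹ * ∑ t ∈ Finset.range n, (φ (Yp t) - c) := fun n =>
    measurable_const.mul (Finset.measurable_sum _ fun t _ =>
      (hφ.comp (measurable_pi_apply t)).sub measurable_const)
  have hGm : ∀ n : ℕ, Measurable fun x : ℕ → S =>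
      (Real.sqrt n)⁻¹ * ∑ t ∈ Finset.range n, (φ (windowPath W x t) - c) := fun n =>
    measurable_const.mul (Finset.measurable_sum _ fun t _ =>
      (hφ.comp (measurable_windowPath_at t)).sub measurable_const)
  refine ⟨fun n => (hGm n).aemeasurable, hZ.aemeasurable, ?_⟩
  convert hclt.tendsto using 2 with n
  apply Subtype.ext
  show P.map _ = (Kernel.trajMeasure (X := fun _ : ℕ => Fin (W + 1) → S)
      (P.map (fun x : ℕ → S => windowPath W x 0))
      (fun n : ℕ => (windowKernel κ W).comap
        (fun hh : (i : ↥(Finset.Iic n)) → (Fin (W + 1) → S) => hh ⟨n, Finset.mem_Iic.2 le_rfl⟩)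
        (measurable_pi_apply _))).map _
  rw [hP, ← chain_map_windowPath κ W μ₀, Measure.map_map (hstatm n) (measurable_windowPath W)]
  rfl

end WindowCLT

end Summit.Ventures.LatticeQCDFlow.Scoring

end
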